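import Summits.HodgeConjecture.HodgeConjecture.Theorems.VHCAbelianSchemesRoadSecantQuotientAnchorPinnedPrimeMarkman
import Summits.HodgeConjecture.HodgeConjecture.Theorems.VHCAbelianSchemesRoadSecantAnchorInhabitedPrimePrime
import HarnessLib

/-!
# Road b02 (`VHCAbelianSchemesRoad`, D-0059) — lane W1, R2: THE PINNED SECANT–QUOTIENT ANCHORS ARE COMPATIBLE ANCHORS, and the P1″ chain
# (plus b03's four existential supply consumers) RE-KEYED to the twice-repaired family supply `SecantAnchorWeilPencilSupply''` (C″)

research route conditional on HC_CM; not a corollary; Q11.4-sentence-2 already refuted in dim ≥ 3.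

THEOREMS ONLY (no definition, no new named fact, `HC_CM` nowhere; nothing of an existing file is edited). ring2-b03x gen 3 on director-hodge
g10's ruling R10.4 (4) «W1: R2 now → node → (G3)» (HOME INBOX 2026-08-27T19:16:55Z; LEAD 158 l.5263 (3)). Context: the displayed family-supply
hypothesis of this road was refuted-misstated TWICE at paper level — `SecantAnchorWeilPencilSupply` (refute-markman g1: off-type witness `E_ω⁶`;
repair C′ = `Supply′`, the binder «`γ` of type `(3,3)`») and `SecantAnchorWeilPencilSupply'` (refute-markman g2: witness `J × Ĵ`, `End J = ℤ`,
`ψ₀ = φ_d`, PRODUCT principal polarisation, INCOMPATIBLE with `ψ₀`; repair C″ = `Supply″`, p559504, the COMPATIBILITY binder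
`ψ₀^*(q^*h) = d·q^*h` of van Geemen 5.2–5.5) —, and every pencil-level regime-2 statement of lane W1 (b02 g88's P1″
`…SecantQuotientAnchorPinnedMarkman` §3, this lineage's `…PinnedPrimeMarkman` §2) is still keyed to the unprimed, refuted `Supply`, while ring2-b03's
four existential consumers (`…SecantAnchorInhabitedPrime` §2) are keyed to `Supply′` and CANNOT be re-keyed from b02's L1 anchor
`HasSecantCarrierWeilAnchor C AdmTw d` alone (it does not record compatibility; b03 g86's honest point). b03 g86 landed the POINTED ∕ inline-∃
replacements at a COMPATIBLE anchor (`…SecantAnchorInhabitedPrimePrime` §2, p560887). THIS FILE discharges them at lane W1's PINNED anchors: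

* §1 **THE COMPATIBILITY BINDER OF `Supply″` HOLDS BY THEOREM AT EVERY SECANT–QUOTIENT DATUM**: `φ_d^*(q^*h_Y(θ₀)) = d·q^*h_Y(θ₀)` on `P = J × Ĵ`
  (`SecantQuotientDatum.complexBetti_map_ψ_map_q_hY`) — Markman Cor. 3.2.3 `φ_d^*Ξ = d·Ξ` (`Markman2025.complexBetti_map_weilOperator_weilPolarizationClass`)
  read through `q^*h_Y(θ₀) = Ξ_d(θ₀)` (`D.complexBetti_map_q_hY`). `Supply″` reads compatibility on `P` through `q^*`, i.e. on the datum's Weil data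
  `(D.P, D.ψ, D.q) = (J × Ĵ, φ_d, q)`; the descended form ON `Y`, `ψ_Y^*h_Y = n²d·h_Y` (`Markman2025.complexBetti_map_descendedWeilOperator_secantPolarizationClass`,
  `n² = (d+1)²` inside `ψ_Y² = −n²d`), is the same fact at `(P, ψ₀, q) := (Y, ψ_Y, 𝟙)` and is not needed here.
* §2 **THE PINNED DATUM IS A COMPATIBLE ANCHOR** (modulo print's pinned claim L1″ `Markman2025_secantQuotient_twistedCarrier_onJacobian_pinned C Adm`,
  any door `Adm`): for every even `d ≥ 4`, a datum `D` with `D.d = d`, a pin `θ₀`, a class `γ` and EVERY binder of `Supply″`'s antecedent at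
  `(D.d, D.P, D.Y, D.ψ, D.q, D.hY θ₀, γ)` — compatibility by §1, type `(3,3)` because `γ = κ₃ − c₃·h_Y(θ₀)³` is ALGEBRAIC —, the pinned anchor
  predicate, and the every-copy `Adm`-datum (`exists_secantQuotientDatum_compatibleClauses_of_pinned`).
* §3 **P1″ RE-KEYED AT C″** (pinned pair `(𝔄^pin, 𝔖^pin)`): `mem_exceptionalPencilClassesThrough_hY_of_supply''` (pointed, at a datum),
  `exists_hasServedFibre_63_secantQuotientPinned_of_pinned_of_supply''` and its two `¬ ∀` forms — verbatim the conclusions of b02 g88's §3 with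
  `hsup : SecantAnchorWeilPencilSupply''` in place of the refuted `SecantAnchorWeilPencilSupply` —, and the primed-door instance
  `not_forall_cell_not_hasServedFibre_63_secantQuotientPinned_of_pinnedPrime_of_supply''` (L1″ read at `AdmTw′`, skeleton v3.3's 2b‴ restriction).
* §4 **b03's INLINE-∃ «COMPATIBLE ANCHOR» DISCHARGED AT THE PINNED ANCHORS** (b02's L2 sets `secantAnchorSixfold C` ∕ `secantServedClasses C`, door of
  record `AdmTw`): `exists_compatibleAnchor_secant_of_pinned` is LITERALLY the hypothesis `hanchor` of b03 g86's
  `not_forall_cell_not_hasServedFibre_63_secant_of_compatibleAnchor_of_supply''`, from L1″(C, AdmTw); hence the four twins of `…SecantAnchorInhabitedPrime`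
  §2 keyed to L1″(C, AdmTw) ∧ `Supply″`, and the full-binder form from L1″ read at the primed door `AdmTw′` (`markmanPinned_admTw_of_admTw'`).

HYGIENE (R10.3 (4) ∕ L158.6): pre-flight `rg 'Theses\.VHCAbelianSchemesRoad\.closes'` over `lean/Summits` = 5 `.lean` hits, all in docstrings, 0
term-level uses; this leaf module ADDS twins — the `…_of_supply` ∕ `…_of_supply'` theorems of record stay byte-identical (kernel-correct statements
modulo paper-refuted hypotheses). STATUS of `Supply″` (b03 g86): «print (van Geemen 5.3–5.5, Markman Cor. 1.3.2 ∕ 4.0.4) for the split-Weil family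
through a COMPATIBLY polarised Weil sixfold; OPEN as a formal statement (no moduli of Weil type in the tree); both refuters' witnesses miss its binders».

Nothing here says L1″, `Supply″`, 2a‴, 2b‴, 2a″, 2b″, any cell, rung, crux, K-SR♭∃, VHC, `HC_AV`, `HC_CM` or HC holds.
References: [cite: Markman2025SecantWeil, §1.3 (p. 5), §1.5 (p. 7), Thm. 1.4.1, Cor. 4.0.4, §3.2 Cor. 3.2.3 and Lemma 9.3.11]
[cite: vanGeemen1994HodgeAV, Lemma 5.2, 5.3–5.5 and Thm. 4.11] [cite: Bloch1972Semiregularity, Remark (7.5)] [cite: MumfordAV1970, §19 and §23]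
[cite: Hartshorne1977, II.3 (p. 89)].
-/

noncomputable section

open CategoryTheory CategoryTheory.Limits AlgebraicGeometry Topology

namespace Summit.HodgeConjecture.HodgeConjecture.Ring2.SemiregularRepresentatives

set_option linter.dupNamespace false -- the cell's namespace repeats the summit name, as in every `Ring2*` file

open Literature.AlgebraicGeometry Literature.AlgebraicGeometry.Motives Literature.AlgebraicGeometry.Motives.AbelianVariety
open Literature.AlgebraicGeometry.HodgeTheory Literature.AlgebraicGeometry.Markman2025
open Literature.AlgebraicTopology.SingularHomology
open Literature.Barriers.HodgeConjecture (divisorClassesSpan)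
open Summit.Ventures.HSemireg (ObjClass)

variable {C : ChernCharacterBetti} {Adm : PerfectAdmissibility}

/-! ## §1 The compatibility binder of `Supply″` holds BY THEOREM at every secant–quotient datum -/

namespace SecantQuotientDatum

variable (D : SecantQuotientDatum)

/-- **`φ_d^*(q^*h_Y(θ₀)) = d·q^*h_Y(θ₀)` — the compatibility binder of `SecantAnchorWeilPencilSupply''` at the Weil data `(J × Ĵ, φ_d, q)` of a
secant–quotient datum, for EVERY class `θ₀`**: Markman's Cor. 3.2.3 `φ_d^*Ξ_d(θ₀) = d·Ξ_d(θ₀)` (van Geemen's condition `E(kx, ky) = Nm(k)E(x, y)`,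
`k = √-d`) read through the defining equation `q^*h_Y(θ₀) = Ξ_d(θ₀) = p₁^*θ₀ + d·p₂^*θ̂₀` of the descended polarisation.
[cite: Markman2025SecantWeil, §3.2 Cor. 3.2.3 and §1.5 (p. 7)] [cite: vanGeemen1994HodgeAV, Lemma 5.2 and 5.3–5.5] -/
theorem complexBetti_map_ψ_map_q_hY (θ₀ : complexBetti D.𝒥.J.X 2) :
    complexBetti.map D.ψ.hom.hom.hom 2 (complexBetti.map D.q.hom.hom.hom 2 (D.hY θ₀)) =
      (D.d : ℂ) • complexBetti.map D.q.hom.hom.hom 2 (D.hY θ₀) := by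
  rw [D.complexBetti_map_q_hY]
  exact complexBetti_map_weilOperator_weilPolarizationClass D.isAmple D.KTheta_eq_bot D.d θ₀

/-- `φ_d ≫ φ_d = -(d • 𝟙)` in the `ℕ`-scalar spelling of the supply hypotheses (private twin of the CM-bridge file's `ψ_comp_ψ_nsmul`, which lives
outside this file's import cone). [cite: Markman2025SecantWeil, §3.2] -/
private theorem ψ_comp_ψ_natSmul : D.ψ ≫ D.ψ = -(D.d • 𝟙 D.P) := by
  rw [D.ψ_comp_ψ, natCast_zsmul]

/-- `0 < d` (the datum has `d ≥ 4`). [cite: Markman2025SecantWeil, §1.5 (p. 7)] -/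
private theorem d_pos : 0 < D.d := lt_of_lt_of_le (by decide) D.four_le

end SecantQuotientDatum

/-! ## §2 The pinned datum is a COMPATIBLE anchor, modulo print's pinned claim L1″ (any door `Adm`) -/

/-- **FROM THE PINNED CLAIM TO A COMPATIBLE ANCHOR** (any `Adm`): for every even `d ≥ 4`, a secant–quotient datum `D` with `D.d = d`, a
polarisation class `θ₀` of `D.Θ`, a class `γ` on `D.Y`, and EVERY binder of the antecedent of `SecantAnchorWeilPencilSupply''` at the Weil data
`(D.d, D.P, D.Y, D.ψ, D.q)` and the pinned classes `(h_Y(θ₀), γ)` — `0 < d`, the dimensions, `φ_d² = -d`, `q^*` bijective, `h_Y(θ₀)` a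
polarisation class (and the class of an AMPLE divisor up to `ℚˣ`), hyperbolicity, **compatibility `φ_d^*(q^*h_Y(θ₀)) = d·q^*h_Y(θ₀)` (§1, a
THEOREM)**, `γ` rational, ALGEBRAIC (hence of type `(3,3)`), off the ray `ℂ·h_Y(θ₀)³`, `q^*γ` a Weil class —, the pinned anchor predicate at the
identity chart, and the every-copy `Adm`-datum. [cite: Markman2025SecantWeil, §1.5 (p. 7), Thm. 1.4.1, Cor. 4.0.4 and §3.2 Cor. 3.2.3]
[cite: vanGeemen1994HodgeAV, Lemma 5.2] [cite: Fulton1998, Prop. 19.1.2] -/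
theorem exists_secantQuotientDatum_compatibleClauses_of_pinned (hM : Markman2025_secantQuotient_twistedCarrier_onJacobian_pinned C Adm)
    {d : ℕ} (hd : Even d) (h4 : 4 ≤ d) :
    ∃ (D : SecantQuotientDatum) (θ₀ : complexBetti D.𝒥.J.X 2) (γ : complexBetti D.Y.X (2 * 3)),
      D.d = d ∧ D.𝒥.J.IsPolarizationClassOf D.Θ θ₀ ∧ 0 < D.d ∧ D.P.dim = 6 ∧ D.Y.dim = 6 ∧ D.ψ ≫ D.ψ = -(D.d • 𝟙 D.P) ∧
      (∀ k : ℕ, Function.Bijective (complexBetti.map D.q.hom.hom.hom k)) ∧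
      IsPolarizationClass 6 D.Y.X (D.hY θ₀) ∧
      (∃ H : CartierDivisor D.Y.X.left, H.IsAmple ∧ D.Y.IsPolarizationClassOf H (D.hY θ₀)) ∧
      IsHyperbolicWeilType D.P D.ψ 3 (complexBetti.map D.q.hom.hom.hom 2 (D.hY θ₀)) ∧
      complexBetti.map D.ψ.hom.hom.hom 2 (complexBetti.map D.q.hom.hom.hom 2 (D.hY θ₀)) =
        (D.d : ℂ) • complexBetti.map D.q.hom.hom.hom 2 (D.hY θ₀) ∧
      IsRationalClass γ ∧ γ ∈ algebraicClasses D.Y.X 3 ∧ IsOfHodgeType 6 D.Y.X (2 * 3) 3 3 γ ∧ γ ∉ (ℂ ∙ cupPowTwo (D.hY θ₀) 3) ∧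
      complexBetti.map D.q.hom.hom.hom (2 * 3) γ ∈ weilClassesOf D.P D.ψ 3 D.d ∧
      IsSecantQuotientWeilClassAtPinned D.Y.X (D.hY θ₀) γ ∧
      ∀ (X' : SchemeOver ℂ) (e : X' ≅ D.Y.X),
        ∃ (I : Finset ℕ) (κ : (k : ℕ) → complexBetti X' (2 * k)) (c : ℕ → ℂ),
          3 ∈ I ∧ twistedReflexiveClass C Adm 6 X' I κ ∧
          κ 3 = complexBetti.map e.hom (2 * 3) γ + c 3 • cupPowTwo (complexBetti.map e.hom 2 (D.hY θ₀)) 3 ∧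
          ∀ k ∈ I, k ≠ 3 → κ k = c k • cupPowTwo (complexBetti.map e.hom 2 (D.hY θ₀)) k := by
  -- the raw datum-level clauses of the pinned claim (b02 g88), keeping `D`'s Weil data by name
  obtain ⟨D₁, θ₁, γ₁, hD₁d, hθ₁, hpol₁, hamp₁, hhyp₁, hγ₁Q, hγ₁ray, hγ₁W, hcopy₁⟩ :=
    exists_secantQuotientDatum_pinnedClauses_of_pinned hM hd h4
  have hW₁ : IsSecantQuotientWeilClassAtPinned D₁.Y.X (D₁.hY θ₁) γ₁ :=
    IsSecantQuotientWeilClassAtPinned.of_refl D₁ hθ₁ hpol₁ hamp₁ hhyp₁ hγ₁Q hγ₁ray hγ₁W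
  have hγ₁alg : γ₁ ∈ algebraicClasses D₁.Y.X 3 := by
    obtain ⟨I, κ, c, h3, hκ, hκ3, -⟩ := hcopy₁ D₁.Y.X (Iso.refl D₁.Y.X)
    have hid2 : complexBetti.map (Iso.refl D₁.Y.X).hom 2 (D₁.hY θ₁) = D₁.hY θ₁ := by
      rw [Iso.refl_hom, complexBetti.map_id]; rfl
    have hid6 : complexBetti.map (Iso.refl D₁.Y.X).hom (2 * 3) γ₁ = γ₁ := by
      rw [Iso.refl_hom, complexBetti.map_id]; rfl
    rw [hid2, hid6] at hκ3
    have hκalg : κ 3 ∈ algebraicClasses D₁.Y.X 3 := mem_algebraicClasses_of_twistedReflexiveClass D₁.Y hκ h3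
    have hθ3 : cupPowTwo (D₁.hY θ₁) 3 ∈ algebraicClasses D₁.Y.X 3 :=
      cupPowTwo_mem_algebraicClasses_of_mem D₁.isSmoothProjective_Y hpol₁.mem_algebraicClasses 3
    have hγeq : γ₁ = κ 3 - c 3 • cupPowTwo (D₁.hY θ₁) 3 := by rw [hκ3, add_sub_cancel_right]
    rw [hγeq]
    exact Submodule.sub_mem _ hκalg (Submodule.smul_mem _ _ hθ3)
  have hγ₁H : IsOfHodgeType 6 D₁.Y.X (2 * 3) 3 3 γ₁ :=
    isOfHodgeType_of_mem_algebraicClasses_of_isSmoothProjective D₁.isSmoothProjective_Y 3 hγ₁alg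
  exact ⟨D₁, θ₁, γ₁, hD₁d, hθ₁, D₁.d_pos, D₁.dim_P, D₁.dim_Y, D₁.ψ_comp_ψ_natSmul, D₁.complexBetti_map_q_bijective, hpol₁, hamp₁,
    hhyp₁, D₁.complexBetti_map_ψ_map_q_hY θ₁, hγ₁Q, hγ₁alg, hγ₁H, hγ₁ray, hγ₁W, hW₁, hcopy₁⟩

/-! ## §3 P1″ re-keyed at C″: inside regime 2 modulo the pinned claim and `SecantAnchorWeilPencilSupply''` -/

/-- **At a secant–quotient datum the pinned-served class lies on an exceptional cell-shaped pencil, modulo `Supply″`** (POINTED form: the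
datum-level binders in, compatibility and the `ℕ`-spellings discharged by §1): `γ ∈ exceptionalPencilClassesThrough 6 3 D.Y.X (h_Y θ₀)`.
[cite: vanGeemen1994HodgeAV, Thm. 4.11 and 5.3–5.5] [cite: Markman2025SecantWeil, Thm. 1.4.1, §1.5 and §3.2 Cor. 3.2.3] -/
theorem mem_exceptionalPencilClassesThrough_hY_of_supply'' (D : SecantQuotientDatum) {θ₀ : complexBetti D.𝒥.J.X 2}
    {γ : complexBetti D.Y.X (2 * 3)} (hpol : IsPolarizationClass 6 D.Y.X (D.hY θ₀))
    (hhyp : IsHyperbolicWeilType D.P D.ψ 3 (complexBetti.map D.q.hom.hom.hom 2 (D.hY θ₀)))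
    (hγQ : IsRationalClass γ) (hγray : γ ∉ (ℂ ∙ cupPowTwo (D.hY θ₀) 3))
    (hγW : complexBetti.map D.q.hom.hom.hom (2 * 3) γ ∈ weilClassesOf D.P D.ψ 3 D.d) (hγH : IsOfHodgeType 6 D.Y.X (2 * 3) 3 3 γ)
    (hsup : SecantAnchorWeilPencilSupply'') : γ ∈ exceptionalPencilClassesThrough 6 3 D.Y.X (D.hY θ₀) :=
  mem_exceptionalPencilClassesThrough_of_compatibleAnchor_of_supply'' D.d_pos D.dim_P D.dim_Y D.ψ_comp_ψ_natSmul
    D.complexBetti_map_q_bijective hpol hhyp (D.complexBetti_map_ψ_map_q_hY θ₀) hγQ hγray hγW hγH hsup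

/-- **P1″ AT C″ — INSIDE REGIME 2, modulo the pinned claim and `SecantAnchorWeilPencilSupply''`.** The twice-repaired family supply, fed with
`D`'s Weil data `(D.d, D.P, D.Y, D.ψ, D.q)` and the pinned classes `(h_Y(θ₀), γ)` of a compatible anchor (§2), yields an exceptional cell-shaped
pencil through the anchor; with the pinned transport `secantQuotientPinned_transport` that pencil satisfies every binder of the cell `(6, 3)`, `W` is
fibrewise rational `(3,3)`, ALGEBRAIC at the anchor fibre, NOT algebraic-Lefschetz on every fibre — regime 2 —, and the anchor fibre is PINNED-SERVED.
Verbatim the conclusion of b02 g88's `exists_hasServedFibre_63_secantQuotientPinned_of_pinned_of_supply`, keyed to `Supply″`.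
[cite: vanGeemen1994HodgeAV, Thm. 4.11 and 5.3–5.5] [cite: Markman2025SecantWeil, Thm. 1.4.1, Cor. 4.0.4, §1.5 and §3.2 Cor. 3.2.3] [cite: Bloch1972Semiregularity, Remark (7.5)] -/
theorem exists_hasServedFibre_63_secantQuotientPinned_of_pinned_of_supply''
    (hM : Markman2025_secantQuotient_twistedCarrier_onJacobian_pinned C Adm) (hsup : SecantAnchorWeilPencilSupply'') :
    ∃ (𝒳 S : SchemeOver ℂ) (f : 𝒳 ⟶ S) (W : complexBetti 𝒳 (2 * 3)) (s₀ : ComplexPoints S),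
      IsSmoothProjectiveFamily f 6 ∧ IsQuasiProjectiveOver 𝒳 ∧ IrreducibleSpace S.left ∧ IsAffine S.left ∧
      AlgebraicGeometry.Smooth S.hom ∧ topologicalKrullDim S.left = 1 ∧
      (∀ s : ComplexPoints S, ∃ A' : AbelianVariety ℂ, A'.dim = 6 ∧ Nonempty (A'.X ≅ fiberOver f s)) ∧
      (∃ e : S ⟶ 𝒳, e ≫ f = 𝟙 S) ∧
      (∀ s : ComplexPoints S, IsRationalClass (complexBetti.map (fiberι f s) (2 * 3) W) ∧
        IsOfHodgeType 6 (fiberOver f s) (2 * 3) 3 3 (complexBetti.map (fiberι f s) (2 * 3) W)) ∧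
      complexBetti.map (fiberι f s₀) (2 * 3) W ∈ algebraicClasses (fiberOver f s₀) 3 ∧
      (¬ ∀ s : ComplexPoints S,
        complexBetti.map (fiberι f s) (2 * 3) W ∈ algebraicClasses (fiberOver f s) 3 ∧
        complexBetti.map (fiberι f s) (2 * 3) W ∈ divisorClassesSpan (fiberOver f s) 6 3) ∧
      HasServedFibre 6 3 (fun X θ ↦ secantQuotientAnchorsPinned X θ) (fun X θ ↦ secantQuotientServedClassesPinned X θ) f W := by
  obtain ⟨D, θ₀, γ, -, -, -, -, -, -, -, hpol, -, hhyp, -, hγQ, hγalg, hγH, hγray, hγW, hW, -⟩ :=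
    exists_secantQuotientDatum_compatibleClauses_of_pinned hM (by decide : Even 4) le_rfl
  exact exists_servedPencil_of_anchor_of_mem_exceptionalPencilClassesThrough secantQuotientPinned_transport D.Y.X (D.hY θ₀)
    ⟨γ, hW⟩ γ hW hγalg (mem_exceptionalPencilClassesThrough_hY_of_supply'' D hpol hhyp hγQ hγray hγW hγH hsup)

/-- **THE PENCIL-LEVEL C2 STATEMENT OF SKELETONS v3.1–v3.3, AT C″** (`¬ ∀`-form): modulo the pinned claim and `Supply″` it is NOT the case that
every smooth projective abelian-sixfold pencil whose class `W` is somewhere exceptional has NO pinned-served fibre (conditional on the claim-tagged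
fact; the tribunal's rider). [cite: Markman2025SecantWeil, Thm. 1.4.1 and §1.5] [cite: vanGeemen1994HodgeAV, Thm. 4.11] [cite: Bloch1972Semiregularity, Remark (7.5)] -/
theorem not_forall_not_hasServedFibre_63_secantQuotientPinned_regimeTwo_of_pinned_of_supply''
    (hM : Markman2025_secantQuotient_twistedCarrier_onJacobian_pinned C Adm) (hsup : SecantAnchorWeilPencilSupply'') :
    ¬ ∀ ⦃𝒳 S : SchemeOver ℂ⦄ (f : 𝒳 ⟶ S) (W : complexBetti 𝒳 (2 * 3)), IsSmoothProjectiveFamily f 6 →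
      (∀ s : ComplexPoints S, ∃ A' : AbelianVariety ℂ, A'.dim = 6 ∧ Nonempty (A'.X ≅ fiberOver f s)) →
      (¬ ∀ s : ComplexPoints S,
        complexBetti.map (fiberι f s) (2 * 3) W ∈ algebraicClasses (fiberOver f s) 3 ∧
        complexBetti.map (fiberι f s) (2 * 3) W ∈ divisorClassesSpan (fiberOver f s) 6 3) →
      ¬ HasServedFibre 6 3 (fun X θ ↦ secantQuotientAnchorsPinned X θ) (fun X θ ↦ secantQuotientServedClassesPinned X θ) f W := by
  intro hnone
  obtain ⟨𝒳, S, f, W, s₀, hf, -, -, -, -, -, hab, -, -, -, hexc, hserved⟩ :=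
    exists_hasServedFibre_63_secantQuotientPinned_of_pinned_of_supply'' hM hsup
  exact hnone f W hf hab hexc hserved

/-- **The same with EVERY binder of `LefAtExceptionalRegimeAt _ 6 3` displayed, AT C″**: modulo the pinned claim and `Supply″` the pinned residual
restriction genuinely excludes a pencil satisfying every hypothesis of the rung in regime 2. [cite: Markman2025SecantWeil, Thm. 1.4.1 and §1.5]
[cite: vanGeemen1994HodgeAV, Thm. 4.11 and 5.3–5.5] [cite: Bloch1972Semiregularity, Remark (7.5)] -/
theorem not_forall_cell_not_hasServedFibre_63_secantQuotientPinned_of_pinned_of_supply''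
    (hM : Markman2025_secantQuotient_twistedCarrier_onJacobian_pinned C Adm) (hsup : SecantAnchorWeilPencilSupply'') :
    ¬ ∀ ⦃𝒳 S : SchemeOver ℂ⦄ (f : 𝒳 ⟶ S), IsSmoothProjectiveFamily f 6 → IsQuasiProjectiveOver 𝒳 →
      IrreducibleSpace S.left → IsAffine S.left → AlgebraicGeometry.Smooth S.hom → topologicalKrullDim S.left = 1 →
      (∀ s : ComplexPoints S, ∃ A' : AbelianVariety ℂ, A'.dim = 6 ∧ Nonempty (A'.X ≅ fiberOver f s)) →
      (∃ e : S ⟶ 𝒳, e ≫ f = 𝟙 S) →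
      ∀ (W : complexBetti 𝒳 (2 * 3)),
        (∀ s : ComplexPoints S, IsRationalClass (complexBetti.map (fiberι f s) (2 * 3) W) ∧
          IsOfHodgeType 6 (fiberOver f s) (2 * 3) 3 3 (complexBetti.map (fiberι f s) (2 * 3) W)) →
        ∀ s₀ : ComplexPoints S,
          complexBetti.map (fiberι f s₀) (2 * 3) W ∈ algebraicClasses (fiberOver f s₀) 3 →
          (¬ ∀ s : ComplexPoints S,
            complexBetti.map (fiberι f s) (2 * 3) W ∈ algebraicClasses (fiberOver f s) 3 ∧
            complexBetti.map (fiberι f s) (2 * 3) W ∈ divisorClassesSpan (fiberOver f s) 6 3) →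
          ¬ HasServedFibre 6 3 (fun X θ ↦ secantQuotientAnchorsPinned X θ) (fun X θ ↦ secantQuotientServedClassesPinned X θ) f W := by
  intro hnone
  obtain ⟨𝒳, S, f, W, s₀, hf, h𝒳, hirr, haff, hsm, hdim, hab, hsec, hW, halg, hexc, hserved⟩ :=
    exists_hasServedFibre_63_secantQuotientPinned_of_pinned_of_supply'' hM hsup
  exact hnone f hf h𝒳 hirr haff hsm hdim hab hsec W hW s₀ halg hexc hserved

/-- **Lane W1's primed instance, AT C″: the defining restriction of the primed residual 2b‴ (`SecantQuotientResidual63PinnedPrime C`: pencils with NO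
pinned-served fibre) FAILS on a pencil satisfying EVERY binder of `LefAtExceptionalRegimeAt _ 6 3` in regime 2**, modulo print's pinned claim L1″ READ
AT THE PRIMED DOOR `AdmTw′ := gluableSigmaAdmissible ∨ bfSingleAdmissible′` and `Supply″` (this lineage's
`not_forall_cell_not_hasServedFibre_63_secantQuotientPinned_of_pinnedPrime_of_supply` re-keyed; the pencil-level predicate is door-free).
[cite: Markman2025SecantWeil, Thm. 1.4.1, §1.5 and Lemma 9.3.11] [cite: vanGeemen1994HodgeAV, Thm. 4.11 and 5.3–5.5] [cite: Bloch1972Semiregularity, Remark (7.5)] -/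
theorem not_forall_cell_not_hasServedFibre_63_secantQuotientPinned_of_pinnedPrime_of_supply''
    (hM : Markman2025_secantQuotient_twistedCarrier_onJacobian_pinned C
      (fun n X₀ I E => Summit.Ventures.HSemireg.gluableSigmaAdmissible n X₀ I E ∨
        Literature.AlgebraicGeometry.HodgeTheory.bfSingleAdmissible' n X₀ I E))
    (hsup : SecantAnchorWeilPencilSupply'') :
    ¬ ∀ ⦃𝒳 S : SchemeOver ℂ⦄ (f : 𝒳 ⟶ S), IsSmoothProjectiveFamily f 6 → IsQuasiProjectiveOver 𝒳 →
      IrreducibleSpace S.left → IsAffine S.left → AlgebraicGeometry.Smooth S.hom → topologicalKrullDim S.left = 1 →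
      (∀ s : ComplexPoints S, ∃ A' : AbelianVariety ℂ, A'.dim = 6 ∧ Nonempty (A'.X ≅ fiberOver f s)) →
      (∃ e : S ⟶ 𝒳, e ≫ f = 𝟙 S) →
      ∀ (W : complexBetti 𝒳 (2 * 3)),
        (∀ s : ComplexPoints S, IsRationalClass (complexBetti.map (fiberι f s) (2 * 3) W) ∧
          IsOfHodgeType 6 (fiberOver f s) (2 * 3) 3 3 (complexBetti.map (fiberι f s) (2 * 3) W)) →
        ∀ s₀ : ComplexPoints S,
          complexBetti.map (fiberι f s₀) (2 * 3) W ∈ algebraicClasses (fiberOver f s₀) 3 →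
          (¬ ∀ s : ComplexPoints S,
            complexBetti.map (fiberι f s) (2 * 3) W ∈ algebraicClasses (fiberOver f s) 3 ∧
            complexBetti.map (fiberι f s) (2 * 3) W ∈ divisorClassesSpan (fiberOver f s) 6 3) →
          ¬ HasServedFibre 6 3 (fun X θ ↦ secantQuotientAnchorsPinned X θ) (fun X θ ↦ secantQuotientServedClassesPinned X θ) f W :=
  not_forall_cell_not_hasServedFibre_63_secantQuotientPinned_of_pinned_of_supply'' hM hsup

/-! ## §4 b03's inline-∃ «compatible anchor» DISCHARGED at the pinned anchors (b02's L2 sets, door of record `AdmTw`) -/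

section CompatibleAnchor

/-- **THE PINNED CLAIM AT THE DOOR OF RECORD SUPPLIES b03's COMPATIBLE ANCHOR** — literally the hypothesis `hanchor` of
`not_forall_cell_not_hasServedFibre_63_secant_of_compatibleAnchor_of_supply''` (`…SecantAnchorInhabitedPrimePrime` §2): Weil data `(d, P, Y, ψ₀, q)`,
classes `(h, γ)` with every binder of `Supply″`'s antecedent (compatibility by §1), `γ` algebraic of type `(3,3)`, and the every-copy memberships
`e^*h ∈ secantAnchorSixfold C X'`, `e^*γ ∈ secantServedClasses C X' (e^*h)` (the every-copy `AdmTw`-datum through ring2-b03's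
`secantAnchor_mem_of_copyDatum`). Witness: `(4, J × Ĵ, Y_4, φ_4, q, h_Y(θ₀), γ)` of the level-`4` pinned datum.
[cite: Markman2025SecantWeil, §1.5 (p. 7), Thm. 1.4.1 (item 4), Cor. 4.0.4 and §3.2 Cor. 3.2.3] [cite: vanGeemen1994HodgeAV, Lemma 5.2]
[cite: Bloch1972Semiregularity, Remark (7.5)] -/
theorem exists_compatibleAnchor_secant_of_pinned
    (hM : Markman2025_secantQuotient_twistedCarrier_onJacobian_pinned C
      (fun n X₀ I E => Summit.Ventures.HSemireg.gluableSigmaAdmissible n X₀ I E ∨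
        Literature.AlgebraicGeometry.HodgeTheory.bfSingleAdmissible n X₀ I E)) :
    ∃ (d : ℕ) (P Y : AbelianVariety ℂ) (ψ₀ : P ⟶ P) (q : P ⟶ Y) (h : complexBetti Y.X 2) (γ : complexBetti Y.X (2 * 3)),
      0 < d ∧ P.dim = 6 ∧ Y.dim = 6 ∧ ψ₀ ≫ ψ₀ = -(d • 𝟙 P) ∧
      (∀ k : ℕ, Function.Bijective (complexBetti.map q.hom.hom.hom k)) ∧ IsPolarizationClass 6 Y.X h ∧
      IsHyperbolicWeilType P ψ₀ 3 (complexBetti.map q.hom.hom.hom 2 h) ∧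
      complexBetti.map ψ₀.hom.hom.hom 2 (complexBetti.map q.hom.hom.hom 2 h) = (d : ℂ) • complexBetti.map q.hom.hom.hom 2 h ∧
      IsRationalClass γ ∧ γ ∈ algebraicClasses Y.X 3 ∧ IsOfHodgeType 6 Y.X (2 * 3) 3 3 γ ∧ γ ∉ (ℂ ∙ cupPowTwo h 3) ∧
      complexBetti.map q.hom.hom.hom (2 * 3) γ ∈ weilClassesOf P ψ₀ 3 d ∧
      ∀ (X' : SchemeOver ℂ) (e : X' ≅ Y.X),
        complexBetti.map e.hom 2 h ∈ secantAnchorSixfold C X' ∧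
          complexBetti.map e.hom (2 * 3) γ ∈ secantServedClasses C X' (complexBetti.map e.hom 2 h) := by
  obtain ⟨D, θ₀, γ, -, -, hd0, hP, hY, hψ, hq, hpol, -, hhyp, hcompat, hγQ, hγalg, hγH, hγray, hγW, -, hcopy⟩ :=
    exists_secantQuotientDatum_compatibleClauses_of_pinned hM (by decide : Even 4) le_rfl
  refine ⟨D.d, D.P, D.Y, D.ψ, D.q, D.hY θ₀, γ, hd0, hP, hY, hψ, hq, hpol, hhyp, hcompat, hγQ, hγalg, hγH, hγray, hγW, fun X' e ↦ ?_⟩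
  obtain ⟨I, κ, c, h3, hκ, hκ3, hκk⟩ := hcopy X' e
  exact secantAnchor_mem_of_copyDatum e hγray h3 hκ hκ3 hκk

/-- **Twin of `exists_servedPencil_regimeTwo_of_hasSecantCarrierWeilAnchor_of_supply'`, keyed to L1″(C, AdmTw) ∧ `Supply″`**: inside regime 2 a
cell-shaped pencil with a served fibre for b02's L2 pair `(secantAnchorSixfold C, secantServedClasses C)` — b03 g86's pointed
`exists_servedPencil_regimeTwo_of_compatibleAnchor_of_supply''` at the compatible anchor of the level-`4` pinned datum.
[cite: vanGeemen1994HodgeAV, Thm. 4.11 and 5.3–5.5] [cite: Markman2025SecantWeil, Thm. 1.4.1, Cor. 4.0.4 and §1.5] [cite: Bloch1972Semiregularity, Remark (7.5)] -/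
theorem exists_servedPencil_regimeTwo_secant_of_pinned_of_supply''
    (hM : Markman2025_secantQuotient_twistedCarrier_onJacobian_pinned C
      (fun n X₀ I E => Summit.Ventures.HSemireg.gluableSigmaAdmissible n X₀ I E ∨
        Literature.AlgebraicGeometry.HodgeTheory.bfSingleAdmissible n X₀ I E))
    (hsup : SecantAnchorWeilPencilSupply'') :
    ∃ (𝒳 S : SchemeOver ℂ) (f : 𝒳 ⟶ S) (W : complexBetti 𝒳 (2 * 3)) (s₀ : ComplexPoints S),
      IsSmoothProjectiveFamily f 6 ∧ IsQuasiProjectiveOver 𝒳 ∧ IrreducibleSpace S.left ∧ IsAffine S.left ∧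
      AlgebraicGeometry.Smooth S.hom ∧ topologicalKrullDim S.left = 1 ∧
      (∀ s : ComplexPoints S, ∃ A' : AbelianVariety ℂ, A'.dim = 6 ∧ Nonempty (A'.X ≅ fiberOver f s)) ∧
      (∃ e : S ⟶ 𝒳, e ≫ f = 𝟙 S) ∧
      (∀ s : ComplexPoints S, IsRationalClass (complexBetti.map (fiberι f s) (2 * 3) W) ∧
        IsOfHodgeType 6 (fiberOver f s) (2 * 3) 3 3 (complexBetti.map (fiberι f s) (2 * 3) W)) ∧
      complexBetti.map (fiberι f s₀) (2 * 3) W ∈ algebraicClasses (fiberOver f s₀) 3 ∧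
      (¬ ∀ s : ComplexPoints S,
        complexBetti.map (fiberι f s) (2 * 3) W ∈ algebraicClasses (fiberOver f s) 3 ∧
        complexBetti.map (fiberι f s) (2 * 3) W ∈ divisorClassesSpan (fiberOver f s) 6 3) ∧
      HasServedFibre 6 3 (fun X θ => θ ∈ secantAnchorSixfold C X) (secantServedClasses C) f W := by
  obtain ⟨d, P, Y, ψ₀, q, h, γ, hd, hP, hY, hψ, hq, hpol, hhyp, hcompat, hγQ, hγalg, hγH, hγoff, hγW, hcopy⟩ :=
    exists_compatibleAnchor_secant_of_pinned hM
  exact exists_servedPencil_regimeTwo_of_compatibleAnchor_of_supply'' hd hP hY hψ hq hpol hhyp hcompat hγQ hγalg hγH hγoff hγW hcopy hsup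

/-- **Twin of `not_forall_not_hasServedFibre_63_secant_regimeTwo_of_markman_of_supply'`, keyed to L1″(C, AdmTw) ∧ `Supply″`** (the `¬ ∀`-form
PART AA-c ∕ AA-d ask for, b02's L2 pair): it is NOT the case that every smooth projective abelian-sixfold pencil whose class `W` is somewhere
exceptional has NO served fibre for the secant data. [cite: Markman2025SecantWeil, Thm. 1.4.1 and §1.5] [cite: vanGeemen1994HodgeAV, Thm. 4.11 and 5.3–5.5]
[cite: Bloch1972Semiregularity, Remark (7.5)] -/
theorem not_forall_not_hasServedFibre_63_secant_regimeTwo_of_pinned_of_supply''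
    (hM : Markman2025_secantQuotient_twistedCarrier_onJacobian_pinned C
      (fun n X₀ I E => Summit.Ventures.HSemireg.gluableSigmaAdmissible n X₀ I E ∨
        Literature.AlgebraicGeometry.HodgeTheory.bfSingleAdmissible n X₀ I E))
    (hsup : SecantAnchorWeilPencilSupply'') :
    ¬ ∀ ⦃𝒳 S : SchemeOver ℂ⦄ (f : 𝒳 ⟶ S) (W : complexBetti 𝒳 (2 * 3)), IsSmoothProjectiveFamily f 6 →
      (∀ s : ComplexPoints S, ∃ A' : AbelianVariety ℂ, A'.dim = 6 ∧ Nonempty (A'.X ≅ fiberOver f s)) →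
      (¬ ∀ s : ComplexPoints S,
        complexBetti.map (fiberι f s) (2 * 3) W ∈ algebraicClasses (fiberOver f s) 3 ∧
        complexBetti.map (fiberι f s) (2 * 3) W ∈ divisorClassesSpan (fiberOver f s) 6 3) →
      ¬ HasServedFibre 6 3 (fun X θ => θ ∈ secantAnchorSixfold C X) (secantServedClasses C) f W := by
  intro hnone
  obtain ⟨𝒳, S, f, W, s₀, hf, -, -, -, -, -, hab, -, -, -, hexc, hserved⟩ :=
    exists_servedPencil_regimeTwo_secant_of_pinned_of_supply'' hM hsup
  exact hnone f W hf hab hexc hserved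

/-- **Twin of `not_forall_cell_not_hasServedFibre_63_secant_of_markman_of_supply'`, keyed to L1″(C, AdmTw) ∧ `Supply″`** (every binder of the cell
displayed): b03 g86's `not_forall_cell_not_hasServedFibre_63_secant_of_compatibleAnchor_of_supply''` with its inline-∃ discharged by
`exists_compatibleAnchor_secant_of_pinned`. [cite: Markman2025SecantWeil, Thm. 1.4.1 and §1.5] [cite: vanGeemen1994HodgeAV, Thm. 4.11 and 5.3–5.5]
[cite: Bloch1972Semiregularity, Remark (7.5)] -/
theorem not_forall_cell_not_hasServedFibre_63_secant_of_pinned_of_supply''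
    (hM : Markman2025_secantQuotient_twistedCarrier_onJacobian_pinned C
      (fun n X₀ I E => Summit.Ventures.HSemireg.gluableSigmaAdmissible n X₀ I E ∨
        Literature.AlgebraicGeometry.HodgeTheory.bfSingleAdmissible n X₀ I E))
    (hsup : SecantAnchorWeilPencilSupply'') :
    ¬ ∀ ⦃𝒳 S : SchemeOver ℂ⦄ (f : 𝒳 ⟶ S), IsSmoothProjectiveFamily f 6 → IsQuasiProjectiveOver 𝒳 →
      IrreducibleSpace S.left → IsAffine S.left → AlgebraicGeometry.Smooth S.hom → topologicalKrullDim S.left = 1 →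
      (∀ s : ComplexPoints S, ∃ A' : AbelianVariety ℂ, A'.dim = 6 ∧ Nonempty (A'.X ≅ fiberOver f s)) →
      (∃ e : S ⟶ 𝒳, e ≫ f = 𝟙 S) →
      ∀ (W : complexBetti 𝒳 (2 * 3)),
        (∀ s : ComplexPoints S, IsRationalClass (complexBetti.map (fiberι f s) (2 * 3) W) ∧
          IsOfHodgeType 6 (fiberOver f s) (2 * 3) 3 3 (complexBetti.map (fiberι f s) (2 * 3) W)) →
        ∀ s₀ : ComplexPoints S,
          complexBetti.map (fiberι f s₀) (2 * 3) W ∈ algebraicClasses (fiberOver f s₀) 3 →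
          (¬ ∀ s : ComplexPoints S,
            complexBetti.map (fiberι f s) (2 * 3) W ∈ algebraicClasses (fiberOver f s) 3 ∧
            complexBetti.map (fiberι f s) (2 * 3) W ∈ divisorClassesSpan (fiberOver f s) 6 3) →
          ¬ HasServedFibre 6 3 (fun X θ => θ ∈ secantAnchorSixfold C X) (secantServedClasses C) f W :=
  not_forall_cell_not_hasServedFibre_63_secant_of_compatibleAnchor_of_supply'' (exists_compatibleAnchor_secant_of_pinned hM) hsup

/-- **Twin of `exists_mem_exceptionalPencilClassesThrough_of_hasSecantCarrierWeilAnchor_of_supply'`, keyed to L1″(C, AdmTw) ∧ `Supply″`**: an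
abelian sixfold `Y` with a polarisation class `h ∈ secantAnchorSixfold C Y.X` and a served `γ ∈ secantServedClasses C Y.X h` — rational, algebraic,
of type `(3,3)`, off `ℂ·h³` — lying on an exceptional cell-shaped pencil, `γ ∈ exceptionalPencilClassesThrough 6 3 Y.X h` (the every-copy memberships at
the identity chart). [cite: vanGeemen1994HodgeAV, Thm. 4.11 and 5.3–5.5] [cite: Markman2025SecantWeil, Thm. 1.4.1 and §1.5] -/
theorem exists_mem_exceptionalPencilClassesThrough_secant_of_pinned_of_supply''
    (hM : Markman2025_secantQuotient_twistedCarrier_onJacobian_pinned C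
      (fun n X₀ I E => Summit.Ventures.HSemireg.gluableSigmaAdmissible n X₀ I E ∨
        Literature.AlgebraicGeometry.HodgeTheory.bfSingleAdmissible n X₀ I E))
    (hsup : SecantAnchorWeilPencilSupply'') :
    ∃ (Y : AbelianVariety ℂ) (h : complexBetti Y.X 2) (γ : complexBetti Y.X (2 * 3)),
      Y.dim = 6 ∧ IsPolarizationClass 6 Y.X h ∧ IsRationalClass γ ∧ γ ∈ algebraicClasses Y.X 3 ∧
      IsOfHodgeType 6 Y.X (2 * 3) 3 3 γ ∧ γ ∉ (ℂ ∙ cupPowTwo h 3) ∧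
      h ∈ secantAnchorSixfold C Y.X ∧ γ ∈ secantServedClasses C Y.X h ∧
      γ ∈ exceptionalPencilClassesThrough 6 3 Y.X h := by
  obtain ⟨d, P, Y, ψ₀, q, h, γ, hd, hP, hY, hψ, hq, hpol, hhyp, hcompat, hγQ, hγalg, hγH, hγoff, hγW, hcopy⟩ :=
    exists_compatibleAnchor_secant_of_pinned hM
  have hid := hcopy Y.X (Iso.refl Y.X)
  have hid2 : complexBetti.map (Iso.refl Y.X).hom 2 h = h := by
    rw [Iso.refl_hom, complexBetti.map_id]; rfl
  have hid6 : complexBetti.map (Iso.refl Y.X).hom (2 * 3) γ = γ := by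
    rw [Iso.refl_hom, complexBetti.map_id]; rfl
  rw [hid2, hid6] at hid
  exact ⟨Y, h, γ, hY, hpol, hγQ, hγalg, hγH, hγoff, hid.1, hid.2,
    mem_exceptionalPencilClassesThrough_of_compatibleAnchor_of_supply'' hd hP hY hψ hq hpol hhyp hcompat hγQ hγoff hγW hγH hsup⟩

/-- **The same four-consumer package from L1″ READ AT THE PRIMED DOOR `AdmTw′`** (lane W1's reading of skeleton v3.3; `markmanPinned_admTw_of_admTw'`):
the full-binder `¬ ∀`-form for b02's L2 pair modulo L1″(C, AdmTw′) ∧ `Supply″`. [cite: Markman2025SecantWeil, Thm. 1.4.1, §1.5 and Lemma 9.3.11]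
[cite: vanGeemen1994HodgeAV, Thm. 4.11 and 5.3–5.5] [cite: Bloch1972Semiregularity, Remark (7.5)] -/
theorem not_forall_cell_not_hasServedFibre_63_secant_of_pinnedPrime_of_supply''
    (hM : Markman2025_secantQuotient_twistedCarrier_onJacobian_pinned C
      (fun n X₀ I E => Summit.Ventures.HSemireg.gluableSigmaAdmissible n X₀ I E ∨
        Literature.AlgebraicGeometry.HodgeTheory.bfSingleAdmissible' n X₀ I E))
    (hsup : SecantAnchorWeilPencilSupply'') :
    ¬ ∀ ⦃𝒳 S : SchemeOver ℂ⦄ (f : 𝒳 ⟶ S), IsSmoothProjectiveFamily f 6 → IsQuasiProjectiveOver 𝒳 →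
      IrreducibleSpace S.left → IsAffine S.left → AlgebraicGeometry.Smooth S.hom → topologicalKrullDim S.left = 1 →
      (∀ s : ComplexPoints S, ∃ A' : AbelianVariety ℂ, A'.dim = 6 ∧ Nonempty (A'.X ≅ fiberOver f s)) →
      (∃ e : S ⟶ 𝒳, e ≫ f = 𝟙 S) →
      ∀ (W : complexBetti 𝒳 (2 * 3)),
        (∀ s : ComplexPoints S, IsRationalClass (complexBetti.map (fiberι f s) (2 * 3) W) ∧
          IsOfHodgeType 6 (fiberOver f s) (2 * 3) 3 3 (complexBetti.map (fiberι f s) (2 * 3) W)) →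
        ∀ s₀ : ComplexPoints S,
          complexBetti.map (fiberι f s₀) (2 * 3) W ∈ algebraicClasses (fiberOver f s₀) 3 →
          (¬ ∀ s : ComplexPoints S,
            complexBetti.map (fiberι f s) (2 * 3) W ∈ algebraicClasses (fiberOver f s) 3 ∧
            complexBetti.map (fiberι f s) (2 * 3) W ∈ divisorClassesSpan (fiberOver f s) 6 3) →
          ¬ HasServedFibre 6 3 (fun X θ => θ ∈ secantAnchorSixfold C X) (secantServedClasses C) f W :=
  not_forall_cell_not_hasServedFibre_63_secant_of_pinned_of_supply'' (markmanPinned_admTw_of_admTw' hM) hsup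

end CompatibleAnchor

end Summit.HodgeConjecture.HodgeConjecture.Ring2.SemiregularRepresentatives

end
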